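import Summits.BirchSwinnertonDyer.BirchSwinnertonDyer.Theorems.RamifiedSevenEllipticUnitsBottomLocalIndexSplitAlgebra
import Summits.BirchSwinnertonDyer.BirchSwinnertonDyer.Theorems.RamifiedSevenEllipticUnitsBottomLocalIndexSplitKummer
import Summits.BirchSwinnertonDyer.BirchSwinnertonDyer.Theorems.RamifiedSevenEllipticUnitsBottomLocalIndexSplitInputs
import Literature.NumberTheory.EllipticCurves.BurungaleKobayashiNakamuraOta2026.PadicEndSpan
import HarnessLib

set_option linter.dupNamespace false
set_option autoImplicit false

/-!
# Route `RamifiedSevenEllipticUnits` (rung K7r), Value crux (19705 → E-Zp `EllipticUnitValueSevenOfGZK`),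
# line `rubin-formula(-zp)`, stub S_B4′: **`λ₀ = c + m_loc` over the CORRECTED carrier `𝒪_𝔭 · z(𝟙)`,
# PROVED from the two arithmetic inputs (sat) and (inj)** (`--supports 19705`; closes nothing by itself)

Cell `bsd-cm`, seat `bsd-cm-k7r-c4` g5 (planner D117 (3): «S_B4′ : (sat) → (inj) → hc → λ₀ = c + m_loc, pure
index algebra = k7r-c4's K1/K2»). HONEST FRAMING: nothing here closes a stub, the crux, the leaf or any
item; BSD is not proved; no named fact is minted. The registered stub `stub_bottomLocalIndexSplitSeven`
of the OLD line `rubin-formula` (item 19705) is typed over the ℤ-span carrier and is vacuous (D117); this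
file proves its honest content over the `p`-adic span (`PadicEndSpan.lean`, p465174), for every prime `p`
and every datum, from exactly two hypotheses — the residue the new line `rubin-formula-zp` files as stubs:

* (sat) `S_{p,rel}(E/K) ≤ E(K) ⊗ ℤ_p` in compact currency: `relaxedCompactSelmerOver (κ.layerSubgroup 0) p {𝔭}
  ≤ mordellWeilKummerSpan p (κ.layerSubgroup 0)` — «`Sel_rel(K, T_pE) = Sel_f(K, T_pE)` (Poitou–Tate, once
  the local Mordell–Weil index is finite) ∧ `T_pШ(E/K) = 0` (GZK: `Ш(E/ℚ)`, `Ш(E′/ℚ)` finite in analytic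
  rank one)»; it ALSO yields conjunct (α) `loc_𝔭(𝒪_𝔭·z(𝟙)) ≤ E(K_𝔭) ⊗ ℤ_p` and k7r-c2's inputs (i), (ii)
  (SB4-RECUT / `…BottomLocalIndexSplitInputs.lean`), while (iii) `E(K) ⊗ ℤ_p ≤ S_{p,rel}` is the PROVED
  `BottomLocalIndexSplit.mordellWeilKummerSpan_le_compactSelmerOver` (p464396);
* (inj) `loc_𝔭` is injective on `E(K) ⊗ ℤ_p` modulo torsion (the `±`-argument of S_dict′; k7r-c3).

## Results (all PROVED)

* `padicPi_mem_mordellWeilKummerSpan` — `E(L) ⊗ ℤ_p` (the Kummer span) is a `ℤ_p`-submodule;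
  `padicEndSpan_le_mordellWeilKummerSpan` — `x ∈ E(K) ⊗ ℤ_p ⇒ 𝒪_𝔭 · x ≤ E(K) ⊗ ℤ_p` (with p464396's
  `End_K`-stability): the carrier lemma behind (α)/(ii) over the corrected span.
* **`hasLocalBottomIndexExpZp_of_sat_of_inj`** — S_B4′: `D.HasBottomIndexExpZp c → (sat) → (inj) →
  HasBottomLocalMordellWeilIndexExp … m → D.HasLocalBottomIndexExpZp (c + m)`, by the product lemma
  `BottomLocalIndexSplit.relIndex_split` (p463989) with `Z = 𝒪_𝔭·z(𝟙)`, `M = E(K) ⊗ ℤ_p`, `G = S_{p,rel}`,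
  `L = E(K_𝔭) ⊗ ℤ_p`, `f = loc_𝔭`.
* `hasLocalBottomIndexExpZp_of_rel_of_sha_of_inj` — the same with (sat) split into its two printed halves
  `S_{p,rel} ≤ S_p(E/K)` (relaxed = compact at the bottom) and `S_p(E/K) ≤ E(K) ⊗ ℤ_p` (`T_pШ = 0`).
* `localBottomIndexExpZp_eq_of_sat_of_inj` — uniqueness form: any `λ₀` of the datum equals `c + m`.

References: [BKNO] arXiv:2608.06879v1 Lemma 7.1, Thm. 7.2, §1.4 [BurungaleKobayashiNakamuraOta2026];
B. Perrin-Riou, Bull. SMF 115 (1987) §0 pp. 401–402 [PerrinRiou1987BSMF]; cell memos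
MEMO-k7r-c4-g5-CARRIER.md §5, SB4-RECUT.md §2 (k7r-c2), STATUS D117 (3).
-/

noncomputable section

open scoped Classical

open WeierstrassCurve NumberField IsDedekindDomain Field
  Literature.NumberTheory.EllipticCurves
  Literature.NumberTheory.EllipticCurves.Rank1Residual
  Literature.NumberTheory.GaloisRepresentations
  Literature.NumberTheory.EllipticCurves.BurungaleKobayashiNakamuraOta2026

universe u

namespace Summit.BirchSwinnertonDyer.BirchSwinnertonDyer.Theorems.RamifiedSevenEllipticUnits

namespace BottomLocalIndexSplit

/-! ## Part 1. `E(L) ⊗ ℤ_p` is a `ℤ_p`-module; the `p`-adic span of a Mordell–Weil class is Mordell–Weil -/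

section Carrier

variable {K : Type u} [Field K] (V : WeierstrassCurve K) (p : ℕ) [Fact p.Prime]
  (H : Subgroup (Field.absoluteGaloisGroup K))

/-- **The Kummer span of a set of fixed points is a `ℤ_p`-submodule**: closed under `padicPi c`
(generators `c'·d` go to `(cc')·d`, `padicPi_padicPi`; `padicPi c` is additive).
[cite: Howard2004HeegnerKolyvagin, §1 (the compact Kummer map `E(L) ⊗ ℤ_p → S_p(E/L)`)] -/
theorem padicPi_mem_kummerSpan_of_mem (S : Set (geomPoints V)) (hS : ∀ P ∈ S, ∀ σ ∈ H, σ • P = P)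
    (c : ℤ_[p]) {x : V.torsionH1Pi p H} (hx : x ∈ V.kummerSpan p H S hS) :
    V.padicPi p H c x ∈ V.kummerSpan p H S hS := by
  unfold kummerSpan at hx ⊢
  induction hx using AddSubgroup.closure_induction with
  | mem y hy =>
    obtain ⟨P, hPS, c', d, hd, rfl⟩ := hy
    rw [padicPi_padicPi]
    exact AddSubgroup.subset_closure ⟨P, hPS, c * c', d, hd, rfl⟩
  | zero => rw [map_zero]; exact zero_mem _
  | add a b _ _ ha hb => rw [map_add]; exact add_mem ha hb
  | neg a _ ha => rw [map_neg]; exact neg_mem ha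

/-- **`E(L) ⊗ ℤ_p` is a `ℤ_p`-submodule** of `∏_k H¹(H, E[p^k])`. [cite: Howard2004HeegnerKolyvagin, §1 (the compact Kummer map `E(L) ⊗ ℤ_p → S_p(E/L)`)] -/
theorem padicPi_mem_mordellWeilKummerSpan (c : ℤ_[p]) {x : V.torsionH1Pi p H}
    (hx : x ∈ V.mordellWeilKummerSpan p H) : V.padicPi p H c x ∈ V.mordellWeilKummerSpan p H :=
  padicPi_mem_kummerSpan_of_mem V p H _ _ c hx

/-- **The `p`-adic `End_K(E)`-span of a Mordell–Weil class is Mordell–Weil**: `x ∈ E(L) ⊗ ℤ_p ⇒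
𝒪_𝔭 · x ≤ E(L) ⊗ ℤ_p` (universal property `padicEndSpan_le` with the `End_K`-stability
`endPi_mem_mordellWeilKummerSpan` and the `ℤ_p`-stability above) — over the corrected carrier this is the
lemma behind k7r-c2's inputs (ii)/(α) once `z(𝟙) ∈ E(K) ⊗ ℤ_p`.
[cite: BurungaleKobayashiNakamuraOta2026, §3.3.1 (arXiv:2608.06879 p. 19) (the module `𝒪·z`; shape only)] -/
theorem padicEndSpan_le_mordellWeilKummerSpan [V.IsElliptic] {x : V.torsionH1Pi p H}
    (hx : x ∈ V.mordellWeilKummerSpan p H) : V.padicEndSpan p H x ≤ V.mordellWeilKummerSpan p H :=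
  V.padicEndSpan_le p H hx (fun _ hφ _ hy ↦ endPi_mem_mordellWeilKummerSpan V p H hφ hy)
    (fun c _ hy ↦ padicPi_mem_mordellWeilKummerSpan V p H c hy)

end Carrier

/-! ## Part 2. S_B4′ over the corrected carrier: `λ₀ = c + m_loc` from (sat) and (inj) -/

section Split

variable {W : WeierstrassCurve ℚ} [W.IsElliptic] {p : ℕ} [Fact p.Prime]
  {K : Type} [Field K] [NumberField K] {𝔭 : HeightOneSpectrum (𝓞 K)} {κ : ZpExtension K p}
  {γ : absoluteGaloisGroup K} {ι : PadicAlgCl p ≃+* ℂ} {φ : HeckeCharacter K} {Ω : ℂ}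
  {𝓔 : AcDualExpSystem W p K 𝔭 κ ι}

/-- **S_B4′ (the bottom index splits into global × local, `λ₀ = c + m_loc`), PROVED over the corrected
carrier from the two arithmetic inputs.** For a datum `D` with bottom index exponent `c` over `𝒪_𝔭 · z(𝟙)`
(`D.HasBottomIndexExpZp c`: `p^c = [S_{p,rel}(E/K) : tors + 𝒪_𝔭·z(𝟙)]`), GIVEN
(sat) `S_{p,rel}(E/K) ≤ E(K) ⊗ ℤ_p` (compact currency; = «`Sel_rel = Sel_f` at the bottom» ∧ «`T_pШ(E/K) = 0`»)
and (inj) `loc_𝔭` injective on `E(K) ⊗ ℤ_p` modulo torsion, every local Mordell–Weil exponent `m`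
(`p^m = [E(K_𝔭) ⊗ ℤ_p : tors + loc_𝔭(E(K) ⊗ ℤ_p)]`) gives the local bottom exponent `c + m`:
`D.HasLocalBottomIndexExpZp (c + m)`, i.e. (α) `loc_𝔭(𝒪_𝔭·z(𝟙)) ≤ E(K_𝔭) ⊗ ℤ_p` AND
`[E(K_𝔭) ⊗ ℤ_p : tors + loc_𝔭(𝒪_𝔭·z(𝟙))] = p^{c+m}`. Proof: `z(𝟙) ∈ S_{p,rel} ≤ E(K) ⊗ ℤ_p` (sat), so
`𝒪_𝔭·z(𝟙) ≤ E(K) ⊗ ℤ_p` (`padicEndSpan_le_mordellWeilKummerSpan`), `E(K) ⊗ ℤ_p ≤ S_p(E/K) ≤ S_{p,rel}`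
(`mordellWeilKummerSpan_le_compactSelmerOver`), `loc_𝔭(E(K) ⊗ ℤ_p) ≤ E(K_𝔭) ⊗ ℤ_p` (p449855), torsion to
torsion; then the product lemma `relIndex_split`. No frame, rank, `κ`-anticyclotomicity, IMC identity or
φ-pinning is used (they matter for S_open only). [cite: BurungaleKobayashiNakamuraOta2026, Lemma 7.1, Thm. 7.2 and §1.4 (arXiv:2608.06879 pp. 8, 40–41) (claim; preprint; shape only)]
[cite: PerrinRiou1987BSMF, §0 pp. 401–402 (the descent sequence `0 → E(L) ⊗ ℤ_p → S_p(L) → T_pШ → 0`)] -/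
theorem hasLocalBottomIndexExpZp_of_sat_of_inj (D : EllipticUnitClassData W p K 𝔭 κ γ ι φ Ω 𝓔) {c m : ℕ}
    (hc : D.HasBottomIndexExpZp c)
    (hsat : (W.baseChange K).relaxedCompactSelmerOver (κ.layerSubgroup 0) p {𝔭} ≤
      (W.baseChange K).mordellWeilKummerSpan p (κ.layerSubgroup 0))
    (hinj : ∀ x ∈ (W.baseChange K).mordellWeilKummerSpan p (κ.layerSubgroup 0),
      (W.baseChange K).localTorsionResPi (closureEmb (K := K) (𝔭.adicCompletion K)) p
          (κ.layerSubgroup 0) x ∈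
        AddCommGroup.torsion (((W.baseChange K).baseChange (𝔭.adicCompletion K)).torsionH1Pi p
          (localSubgroupOfEmb (κ.layerSubgroup 0) (closureEmb (K := K) (𝔭.adicCompletion K)))) →
      x ∈ AddCommGroup.torsion ((W.baseChange K).torsionH1Pi p (κ.layerSubgroup 0)))
    (hm : HasBottomLocalMordellWeilIndexExp W p K 𝔭 κ m) :
    D.HasLocalBottomIndexExpZp (c + m) := by
  have hc' := hc
  have hm' := hm
  unfold EllipticUnitClassData.HasBottomIndexExpZp at hc'
  unfold HasBottomLocalMordellWeilIndexExp WeierstrassCurve.HasLocalMordellWeilIndexExpOfEmb at hm'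
  have hMG : (W.baseChange K).mordellWeilKummerSpan p (κ.layerSubgroup 0) ≤
      (W.baseChange K).relaxedCompactSelmerOver (κ.layerSubgroup 0) p {𝔭} :=
    (mordellWeilKummerSpan_le_compactSelmerOver (W.baseChange K) p (κ.layerSubgroup 0)).trans
      ((W.baseChange K).compactSelmerOver_le_relaxedCompactSelmerOver (κ.layerSubgroup 0) p {𝔭})
  have hZM : (W.baseChange K).padicEndSpan p (κ.layerSubgroup 0) (D.z 0) ≤
      (W.baseChange K).mordellWeilKummerSpan p (κ.layerSubgroup 0) :=
    padicEndSpan_le_mordellWeilKummerSpan (W.baseChange K) p (κ.layerSubgroup 0) (hsat (D.z_mem 0))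
  have hML := (W.baseChange K).map_localTorsionResPi_mordellWeilKummerSpan_le
    (closureEmb (K := K) (𝔭.adicCompletion K)) p (κ.layerSubgroup 0)
  have hinj' : (W.baseChange K).mordellWeilKummerSpan p (κ.layerSubgroup 0) ⊓
      (AddCommGroup.torsion _).comap ((W.baseChange K).localTorsionResPi
        (closureEmb (K := K) (𝔭.adicCompletion K)) p (κ.layerSubgroup 0)) ≤
      AddCommGroup.torsion _ :=
    fun x hx ↦ hinj x (AddSubgroup.mem_inf.1 hx).1 (AddSubgroup.mem_comap.1 (AddSubgroup.mem_inf.1 hx).2)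
  refine ⟨hML.trans' (AddSubgroup.map_mono hZM), ?_⟩
  unfold WeierstrassCurve.localPadicEndSpanOfEmb
  rw [relIndex_split _ (AddCommGroup.torsion _) _ _ _ (AddCommGroup.torsion _) _ hZM hMG
    (hsat.trans le_sup_right) (LocalIndexSplitReading.map_torsion_le _) hML hinj', hc', hm', pow_add]

/-- **S_B4′ with (sat) split into its two printed halves**: (rel) `S_{p,rel}(E/K) ≤ S_p(E/K)` (relaxed =
compact at the bottom: [BKNO]'s `Sel_rel = Sel_f` once the local Mordell–Weil index is finite, Poitou–Tate)
and (sha) `S_p(E/K) ≤ E(K) ⊗ ℤ_p` (`T_pШ(E/K) = 0`: finiteness of `Ш(E/K)[p^∞]`, GZK in analytic rank one).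
[cite: PerrinRiou1987BSMF, §0 pp. 401–402 (the descent sequence `0 → E(L) ⊗ ℤ_p → S_p(L) → T_pШ → 0`)]
[cite: BurungaleKobayashiNakamuraOta2026, §3.1.2 and Lemma 7.1 (arXiv:2608.06879 pp. 16, 40) (claim; preprint; shape only)] -/
theorem hasLocalBottomIndexExpZp_of_rel_of_sha_of_inj (D : EllipticUnitClassData W p K 𝔭 κ γ ι φ Ω 𝓔)
    {c m : ℕ} (hc : D.HasBottomIndexExpZp c)
    (hrel : (W.baseChange K).relaxedCompactSelmerOver (κ.layerSubgroup 0) p {𝔭} ≤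
      (W.baseChange K).compactSelmerOver (κ.layerSubgroup 0) p)
    (hsha : (W.baseChange K).compactSelmerOver (κ.layerSubgroup 0) p ≤
      (W.baseChange K).mordellWeilKummerSpan p (κ.layerSubgroup 0))
    (hinj : ∀ x ∈ (W.baseChange K).mordellWeilKummerSpan p (κ.layerSubgroup 0),
      (W.baseChange K).localTorsionResPi (closureEmb (K := K) (𝔭.adicCompletion K)) p
          (κ.layerSubgroup 0) x ∈
        AddCommGroup.torsion (((W.baseChange K).baseChange (𝔭.adicCompletion K)).torsionH1Pi p
          (localSubgroupOfEmb (κ.layerSubgroup 0) (closureEmb (K := K) (𝔭.adicCompletion K)))) →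
      x ∈ AddCommGroup.torsion ((W.baseChange K).torsionH1Pi p (κ.layerSubgroup 0)))
    (hm : HasBottomLocalMordellWeilIndexExp W p K 𝔭 κ m) :
    D.HasLocalBottomIndexExpZp (c + m) :=
  hasLocalBottomIndexExpZp_of_sat_of_inj D hc (hrel.trans hsha) hinj hm

/-- **Uniqueness form of S_B4′**: under (sat) and (inj), every local bottom exponent `λ₀` of the datum
over the corrected carrier equals `c + m_loc`. [cite: BurungaleKobayashiNakamuraOta2026, Thm. 7.2 and §1.4 (arXiv:2608.06879 pp. 8, 41) (claim; preprint; shape only)] -/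
theorem localBottomIndexExpZp_eq_of_sat_of_inj (D : EllipticUnitClassData W p K 𝔭 κ γ ι φ Ω 𝓔)
    {c m l : ℕ} (hc : D.HasBottomIndexExpZp c)
    (hsat : (W.baseChange K).relaxedCompactSelmerOver (κ.layerSubgroup 0) p {𝔭} ≤
      (W.baseChange K).mordellWeilKummerSpan p (κ.layerSubgroup 0))
    (hinj : ∀ x ∈ (W.baseChange K).mordellWeilKummerSpan p (κ.layerSubgroup 0),
      (W.baseChange K).localTorsionResPi (closureEmb (K := K) (𝔭.adicCompletion K)) p
          (κ.layerSubgroup 0) x ∈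
        AddCommGroup.torsion (((W.baseChange K).baseChange (𝔭.adicCompletion K)).torsionH1Pi p
          (localSubgroupOfEmb (κ.layerSubgroup 0) (closureEmb (K := K) (𝔭.adicCompletion K)))) →
      x ∈ AddCommGroup.torsion ((W.baseChange K).torsionH1Pi p (κ.layerSubgroup 0)))
    (hm : HasBottomLocalMordellWeilIndexExp W p K 𝔭 κ m) (hl : D.HasLocalBottomIndexExpZp l) :
    l = c + m :=
  D.hasLocalBottomIndexExpZp_unique hl (hasLocalBottomIndexExpZp_of_sat_of_inj D hc hsat hinj hm)

end Split

end BottomLocalIndexSplit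

end Summit.BirchSwinnertonDyer.BirchSwinnertonDyer.Theorems.RamifiedSevenEllipticUnits

end
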